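import Literature.MathematicalPhysics.QuantumFieldTheory.Borinsky2020.SecondSymanzikPermutahedron
import Mathlib.LinearAlgebra.Matrix.PosDef
import Mathlib.Analysis.InnerProductSpace.GramMatrix
import HarnessLib

/-!
# Kinematic regimes from the Gram matrix `𝒫` (Euclidean ⊂ pseudo-Euclidean | Minkowski; generic | exceptional) and the generalized-permutahedron property of `ℱ` in ALL regimes under generic kinematics — Borinsky–Munch–Tellander 2023 §2.2, Theorem 3.6, Theorem 3.9 — PROVED

**Source.** M. Borinsky, H. J. Munch, F. Tellander, *Tropical Feynman integration in the Minkowski regime*, Comput. Phys.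
Commun. 292 (2023) 108874, arXiv:2302.08955 [cite: BorinskyMunchTellander2023] — §2.1 eq. (polyUF), §2.2 "Kinematic regimes",
§3.3 Theorems 3.5, 3.6, 3.9 (source lines: `main.tex` of the arXiv source). Companion files: `Borinsky2020/SecondSymanzikPermutahedron`
(Borinsky 2020 Theorem 32 = BMT23 Theorem 3.5 for Euclidean vector momenta: `secondSymanzikPolynomial`, `zSecondSymanzik`,
`newtonPolytope_secondSymanzikPolynomial_eq_gpPolytope`, `…_subset_gpPolytope`), `Borinsky2020/GeneralizedPermutahedra` (`gpPolytope`).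

**What the source says (verbatim).** (polyUF, l.304–305) "𝒰(x) = Σ_T Π_{e∉T} x_e, ℱ(x) = −Σ_F p(F)² Π_{e∉F} x_e + 𝒰(x) Σ_{e∈E} m_e² x_e,
where we sum over all spanning trees T and all spanning two-forests F of G, and p(F)² is the Minkowski squared momentum running between
the two-forest components." (§2.2, l.326–332) "the value of the Feynman integral (prop) only depends on the |V|×|V| Gram matrix 𝒫^{u,v}
= p_u·p_v … The following characterisation of the different *kinematic regimes* that we propose will therefore only take the input of
a symmetric |V|×|V| matrix 𝒫 with vanishing row and column sums (i.e. the momentum conservation conditions Σ_{v∈V} p_u·p_v = Σ_{v∈V}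
𝒫^{u,v} = 0 for all u ∈ V), without requiring any explicit knowledge of the p_v vectors." Then the four paragraphs *Euclidean regime*
(l.334–341: "𝒫 is negative semi-definite. In this regime, ℱ(x) ≥ 0 for all x ∈ ℙ^E_+ … 𝒫 = −𝒬ᵀ𝒬 … 𝒫^{u,v} = −p̃_uᵀ p̃_v"),
*Pseudo-Euclidean regime* (l.344–368: eq. (pQE) "Σ_{u,v∈V'} 𝒫^{u,v} ≤ 0" for each V' ⊂ V; "the coefficients of ℱ are non-negative in
the pseudo-Euclidean regime"; "the Euclidean regime is contained in the pseudo-Euclidean regime"), *Minkowski regime* (l.371–374),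
*Generic and exceptional kinematics* (l.376–394: internal/external vertices; eq. (generic kinematics) "Σ_{u,v∈V'} 𝒫^{u,v} ≠ Σ_{e∈E'}
m_e²" for proper V' ⊊ V^ext and non-empty E' ⊂ E; "the kinematics are always generic in the pseudo-Euclidean regime if m_e > 0 for
all e ∈ E or if Σ_{u,v∈V'} 𝒫^{u,v} < 0 for all V' ⊊ V^ext"; "generic kinematics also exclude on-shell external momenta … as long as
not all m_e > 0"; "Genericity, for instance, guarantees that there will be no cancellation between the momentum and the mass part of the
ℱ-polynomial"; "Kinematic configurations that are not generic are called exceptional."). THEOREM 3.5 (l.740–748): "In the Euclidean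
regime with generic kinematics, the Newton polytope N[ℱ] is a generalized permutahedron. It is equal to the base polytope P[z_ℱ] with
the function z_ℱ defined for all subgraphs γ by z_ℱ(γ) = L_γ + 1 if γ is mass-momentum spanning and z_ℱ(γ) = L_γ otherwise.
Consequently, this function z_ℱ : 2^E → ℝ is supermodular". THEOREM 3.6 (l.766–779): "Theorem 3.5 holds in all regimes if the
kinematics are generic. *Proof.* The ℱ polynomial has the same monomials (with different coefficients) as in the Euclidean regime with
generic kinematics. To verify this, note that the conditions for generic kinematics prevent cancellations between the mass and momentum
part of the ℱ polynomial as given in eq. (polyUF). So, the respective Newton polytopes coincide." THEOREM 3.9 (l.855–859): "Even if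
N[ℱ] ≠ P[z_ℱ], the Newton polytope N[ℱ] is *bounded* by the base polytope P[z_ℱ]. The reason for this is that ℱ can only lose
monomials if we make the kinematics less generic. Theorem 3.9. We have N[ℱ] ⊂ P[z_ℱ]."

**What is typed here (all PROVED; 0 named facts).** Kinematics = a real matrix `P : Matrix (Fin (V+1)) (Fin (V+1)) ℝ` with
hypotheses `P.IsSymm` and `∀ u, Σ_v P u v = 0` exactly as the source prescribes; `sqMomentum P V' = Σ_{u,v∈V'} 𝒫^{u,v}`; the regimes
`IsEuclidean` (`(−P).PosSemidef`), `IsPseudoEuclidean`, `IsMinkowski`, `IsExternal`, `IsGeneric`, `IsExceptional` (Part 1); the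
polynomial `gramSecondSymanzik E P m` = eq. (polyUF) with `p(F)²` read off `𝒫` and `z_ℱ = zGram E P m` (Part 2); the elementary
`𝒫`-facts incl. "Euclidean ⊂ pseudo-Euclidean" (`IsEuclidean.isPseudoEuclidean`) and "no lone external vertex" (Part 3); the monomial
bookkeeping of (polyUF): the coefficient of `x^{𝟙_{E∖F}}` at a spanning 2-forest is `−p(F)² + Σ_{e∈cut(F)} m_e²`, every other
coefficient does not see the momenta (`coeff_twoForestPolynomial_twoForest`, `support_twoForestPolynomial_subset/eq`, Part 4); Part 5
realises the printed proof of Theorem 3.6: auxiliary Euclidean generic momenta `p̃` with the same external vertices (`auxMomenta`,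
`isGenericMomenta_auxMomenta`), "no cancellation" (`of_gramCoeff_eq_zero`, `coeff_gramSecondSymanzik_ne_zero`), "the same monomials"
(`support_gramSecondSymanzik_eq`), "can only lose monomials" (`support_gramSecondSymanzik_subset`); Part 6: **THEOREM 3.6**
`newtonPolytope_gramSecondSymanzik_eq_gpPolytope` (`NP⟦ℱ⟧ = gpPolytope z_ℱ` for every symmetric conserved `𝒫`, real masses, generic
kinematics, connected edge list), `supermodular_zGram`, **THEOREM 3.9** `newtonPolytope_gramSecondSymanzik_subset_gpPolytope` (no
genericity), the sign statements `coeff_gramSecondSymanzik_nonneg` / `eval_gramSecondSymanzik_nonneg` (pseudo-Euclidean ⇒ coefficients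
and values on `ℝ^E_{≥0}` are `≥ 0`), on-shell ⇒ exceptional (`IsGeneric.apply_self_ne_zero`, `isExceptional_of_onShell`), the two
printed sufficient conditions for genericity; Part 7: the dictionary for Euclidean vector momenta in a real inner-product space,
`allMinusGram p = −(⟪p̃_u,p̃_v⟫)` ("𝒫 = −𝒬ᵀ𝒬"): it is Euclidean, conserved, `ℱ(𝒫) = Φ_G(p̃)` (`gramSecondSymanzik_allMinusGram`),
`z_ℱ(𝒫) = z_Φ(p̃)`, Euclidean generic momenta are generic kinematics, and Theorem 3.6 restricted to it is the companion's Theorem 32 /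
BMT23 Theorem 3.5 (`newtonPolytope_secondSymanzikPolynomial_eq_gpPolytope_of_inner`).

**Readings (disclosed).** (i) In (generic kinematics) `V'` ranges over the NON-EMPTY proper subsets of `V^ext` (see `IsGeneric`: at
`V' = ∅` the printed text is inconsistent with its own next sentence; this is Brown's (genericmomenta) reading used by the companion).
(ii) "mass-momentum spanning" is typed combinatorially (`IsMassMomentumSpanningGram`: all massive edges in `γ`, all external vertices
joined by `γ` — Brown Def. 2.6 / Borinsky 2020 §7.1), not by BMT23's "ℱ_{G/γ} = 0"; the two agree under generic kinematics (Brown eq.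
(2.5), typed for vector momenta in `SecondSymanzikFactorization.lean`) and may differ for exceptional kinematics, where BMT23's `z_ℱ`
is pointwise `≥ zGram` — so the Theorem 3.9 typed here (`⊆ gpPolytope zGram`) is implied by, and for exceptional kinematics possibly
weaker than, the printed inclusion. (iii) `P[z]` is the tree's facet presentation `gpPolytope` (BMT23 Theorem 3.3 taken "as our
definition", as in the companion). (iv) Masses are real and enter through `m_e²` ("m_e > 0" ↦ `m_e ≠ 0`).

**What the source does NOT say (and this file does not claim).** Nothing here asserts `N[ℱ] = P[z_ℱ]` for exceptional kinematics:
BMT23 prints that for the Euclidean regime as CONJECTURE 3.7 (l.780–786, "Theorem 3.5 holds in the Euclidean regime for all (also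
exceptional) kinematics"), prints Observation 3.8 ("often equal") and an explicit exceptional counterexample (the QED triangle, l.846:
"ℱ(x) = m²(x_1² + x_2²) + (2m² − Q²) x_1 x_2 … N[ℱ] is different from P[z_ℱ]") — none of these is typed; nothing about the sign of `ℱ`
in the Minkowski regime, analytic continuation / contour deformation, or convergence of the integral; `IsMinkowski`/`IsExceptional` are
the printed complements and carry no further content.

**Proof route.** Theorem 3.6 exactly as printed — same support as a Euclidean generic configuration — with the Euclidean configuration
made explicit (`auxMomenta`: `p̃_v = 𝟙_v − 𝟙_{V^ext}/|V^ext| ∈ ℝ^V` for external `v`), to which the companion's Theorem 32 applies;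
the coefficient comparison is the (polyUF) bookkeeping of Part 4 plus (generic kinematics) at `V' = V^ext ∩ (one side of F)`,
`E' = cut(F)` (non-empty because `G` is connected: matroid base extension). Theorem 3.9: the support of `ℱ(𝒫)` is contained in that of
`Φ_G(p̃)` for every symmetric conserved `𝒫`, then the companion's inclusion. Mathlib: `Matrix.PosSemidef`, `Matrix.gram`,
`Matroid.Indep.exists_isBase_superset`, `MvPolynomial` coefficients. D-0026: no new `def … : Prop` fact; helpers proved inline.
-/

noncomputable section

namespace Literature.MathematicalPhysics.QuantumFieldTheory.BorinskyMunchTellander2023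

open Finset MvPolynomial Matrix
open Literature.MathematicalPhysics.QuantumFieldTheory
open Literature.MathematicalPhysics.QuantumFieldTheory.Borinsky2020

variable {N V : ℕ} (E : Fin N → Fin (V + 1) × Fin (V + 1))

/-! ## Part 1 — BMT23 §2.2: kinematics as a symmetric matrix `𝒫` with vanishing row sums; the regimes -/

section Regimes

/-- **`(Σ_{v∈V'} p_v)² = Σ_{u,v∈V'} p_u·p_v = Σ_{u,v∈V'} 𝒫^{u,v}`** — the squared total momentum of a vertex set `V'`, read off
the matrix `𝒫` ("The first two equalities in (pQE) are only included as mnemonic devices; knowledge of 𝒫 is sufficient to check the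
inequalities"). [cite: BorinskyMunchTellander2023, §2.2 eq. (pQE) and eq. (generic kinematics) (main.tex l.347–349, l.385)] -/
def sqMomentum (P : Matrix (Fin (V + 1)) (Fin (V + 1)) ℝ) (S : Finset (Fin (V + 1))) : ℝ := ∑ u ∈ S, ∑ v ∈ S, P u v

/-- **External vertex**: "we call a vertex v *internal* if 𝒫^{u,v} = 0 for all u ∈ V and *external* otherwise."
[cite: BorinskyMunchTellander2023, §2.2 "Generic and exceptional kinematics" (main.tex l.377–380)] -/
def IsExternal (P : Matrix (Fin (V + 1)) (Fin (V + 1)) ℝ) (v : Fin (V + 1)) : Prop := ∃ u, P u v ≠ 0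

/-- **Euclidean regime**: "We say a given Feynman integral computation problem is in the *Euclidean regime* if the matrix 𝒫 is
negative semi-definite" — typed as Mathlib's `Matrix.PosSemidef (−𝒫)` (which includes the symmetry of `𝒫`).
[cite: BorinskyMunchTellander2023, §2.2 "Euclidean regime" (main.tex l.334–335)] -/
def IsEuclidean (P : Matrix (Fin (V + 1)) (Fin (V + 1)) ℝ) : Prop := (-P).PosSemidef

/-- **Pseudo-Euclidean regime**: "If for each subset V' ⊂ V of the vertices the inequality (Σ_{v∈V'} p_v)² = Σ_{u,v∈V'} p_u·p_v =
Σ_{u,v∈V'} 𝒫^{u,v} ≤ 0 is respected, then we are in the *pseudo-Euclidean* regime. … Equivalently, we can require the element sums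
of all *principle minor matrices* of the 𝒫 matrix to be ≤ 0." [cite: BorinskyMunchTellander2023, §2.2 eq. (pQE) (main.tex l.346–351)] -/
def IsPseudoEuclidean (P : Matrix (Fin (V + 1)) (Fin (V + 1)) ℝ) : Prop := ∀ S : Finset (Fin (V + 1)), sqMomentum P S ≤ 0

/-- **Minkowski regime**: "If we are not in the pseudo-Euclidean regime (and thereby also not in the Euclidean regime), then we
are in the *Minkowski regime*." [cite: BorinskyMunchTellander2023, §2.2 "Minkowski regime" (main.tex l.371–374)] -/
def IsMinkowski (P : Matrix (Fin (V + 1)) (Fin (V + 1)) ℝ) : Prop := ¬ IsPseudoEuclidean P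

/-- **Generic kinematics**: "we say that our kinematics are *generic* if for each *proper* subset V' ⊊ V^ext of the external
vertices of G and for each non-empty subset E' ⊂ E of the edges of G we have (Σ_{v∈V'} p_v)² = Σ_{u,v∈V'} p_u·p_v = Σ_{u,v∈V'}
𝒫^{u,v} ≠ Σ_{e∈E'} m_e²." READING (disclosed): `V'` ranges over the NON-EMPTY proper subsets of `V^ext`. For `V' = ∅` the printed
condition `0 ≠ Σ_{e∈E'} m_e²` for every non-empty `E'` would force every edge massive, contradicting the paper's next sentence "the
kinematics are always generic in the pseudo-Euclidean regime if m_e > 0 for all e ∈ E **or** if Σ_{u,v∈V'} 𝒫^{u,v} < 0 for all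
V' ⊊ V^ext" (whose second alternative is itself unsatisfiable at `V' = ∅`); it is the reading of Brown's (genericmomenta) used by
the companion's `IsGenericMomenta`, and the one under which Theorem 3.6 is proved below. Masses enter only through `m_e²`.
[cite: BorinskyMunchTellander2023, §2.2 eq. (generic kinematics) (main.tex l.381–390)] -/
def IsGeneric (P : Matrix (Fin (V + 1)) (Fin (V + 1)) ℝ) (m : Fin N → ℝ) : Prop :=
  ∀ S : Finset (Fin (V + 1)), S.Nonempty → (∀ v ∈ S, IsExternal P v) → (∃ v, IsExternal P v ∧ v ∉ S) →
    ∀ E' : Finset (Fin N), E'.Nonempty → sqMomentum P S ≠ ∑ e ∈ E', m e ^ 2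

/-- **Exceptional kinematics**: "Kinematic configurations that are not generic are called *exceptional*."
[cite: BorinskyMunchTellander2023, §2.2 (main.tex l.394)] -/
def IsExceptional (P : Matrix (Fin (V + 1)) (Fin (V + 1)) ℝ) (m : Fin N → ℝ) : Prop := ¬ IsGeneric P m

end Regimes

/-! ## Part 2 — `ℱ` from `𝒫` (eq. (polyUF)); the shape it shares with the companion's Euclidean `Φ_G`; `z_ℱ` from `𝒫` -/

section Polynomials

variable {W : Type*} [NormedAddCommGroup W]

open scoped Classical in
/-- The common shape of eq. (polyUF)'s "ℱ(x) = −Σ_F p(F)² Π_{e∉F} x_e + 𝒰(x) Σ_{e∈E} m_e² x_e" and of the companion's Euclidean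
`Φ_G = Σ_{T₂} ‖p(T₂)‖² Π_{e∉T₂} x_e + Ψ_G Σ_e m_e² x_e` (`secondSymanzikPolynomial`, Borinsky eq. (PsiPhi_slow)): a real coefficient
`c(F)` on each spanning 2-forest `F` plus the mass term `𝒰 · Σ_e m_e² x_e` — so that the support bookkeeping is done once for both.
[cite: BorinskyMunchTellander2023, §2.1 eq. (polyUF) (main.tex l.304–305); Borinsky2020, §7.1 eq. (PsiPhi_slow) (tropical.tex l.1185–1187)] -/
def twoForestPolynomial (c : Finset (Fin N) → ℝ) (m : Fin N → ℝ) : MvPolynomial (Fin N) ℝ :=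
  (∑ F ∈ univ.filter (IsSpanningTwoForest E), c F • ∏ e ∈ Fᶜ, X e) +
    kirchhoffPolynomial ℝ E * ∑ e, m e ^ 2 • X e

open scoped Classical in
/-- The root-side vertex set of the graph spanned by `F` on all `V + 1` vertices — for a spanning 2-forest one of its two components
(the one containing the vertex `0`); the companion's `momentumFlow E F p` is `Σ_{v ∈ rootSide E F} p_v` (`momentumFlow_eq_sum_rootSide`).
[cite: Borinsky2020, §7.1 after eq. (PsiPhi_slow) ("p(T₂) is the total momentum flowing between the two components of the 2-forest T₂", tropical.tex l.1187)] -/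
def rootSide (F : Finset (Fin N)) : Finset (Fin (V + 1)) :=
  univ.filter fun v => (edgeGraph E F).Reachable 0 v

/-- **The cut of `F`**: the edges `e ∉ F` whose insertion turns `F` into a spanning tree — for a spanning 2-forest `F`, the edges
of `G` joining its two components; equivalently the pairs (spanning tree `T`, edge `e ∈ T`) with `T ∖ e = F` (Brown, proof of Lemma
1.12: "Delete any edge e' in this path to obtain a spanning 2-tree T∖e' = T_1 ∪ T_2"), which index the mass monomials of (polyUF)
meeting the 2-forest monomial of `F`. [cite: Brown2017, Lemma 1.12 (proof); BorinskyMunchTellander2023, §2.1 eq. (polyUF)] -/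
def cutEdges (F : Finset (Fin N)) : Finset (Fin N) :=
  univ.filter fun e => e ∉ F ∧ IsSpanningTree E (insert e F)

/-- **"ℱ(x) = −Σ_F p(F)² Π_{e∉F} x_e + 𝒰(x) Σ_{e∈E} m_e² x_e, where we sum over all spanning trees T and all spanning two-forests F of
G, and p(F)² is the Minkowski squared momentum running between the two-forest components"** — with `p(F)²` READ OFF `𝒫` as
`Σ_{u,v∈V'} 𝒫^{u,v}`, `V'` the root side of `F` ("[the classification] will therefore only take the input of a symmetric |V|×|V|
matrix 𝒫 with vanishing row and column sums … without requiring any explicit knowledge of the p_v vectors"; which side is immaterial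
under momentum conservation, `sqMomentum_compl`), `𝒰 = kirchhoffPolynomial ℝ E`, real masses `m`.
[cite: BorinskyMunchTellander2023, §2.1 eq. (polyUF) (main.tex l.304–305), §2.2 (main.tex l.329–332)] -/
def gramSecondSymanzik (P : Matrix (Fin (V + 1)) (Fin (V + 1)) ℝ) (m : Fin N → ℝ) : MvPolynomial (Fin N) ℝ :=
  twoForestPolynomial E (fun F => -sqMomentum P (rootSide E F)) m

/-- The companion's `p(T₂)` is the momentum entering the root side. [cite: Borinsky2020, §7.1 after eq. (PsiPhi_slow) (tropical.tex l.1187)] -/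
theorem momentumFlow_eq_sum_rootSide (F : Finset (Fin N)) (p : Fin (V + 1) → W) :
    momentumFlow E F p = ∑ v ∈ rootSide E F, p v := rfl

/-- The companion's Euclidean `Φ_G` has the shape of eq. (polyUF) with `c(T₂) = ‖p(T₂)‖²`.
[cite: Borinsky2020, §7.1 eq. (PsiPhi_slow) (tropical.tex l.1185–1187); BorinskyMunchTellander2023, §2.1 eq. (polyUF)] -/
theorem secondSymanzikPolynomial_eq_twoForestPolynomial (p : Fin (V + 1) → W) (m : Fin N → ℝ) :
    secondSymanzikPolynomial E p m = twoForestPolynomial E (fun F => ‖momentumFlow E F p‖ ^ 2) m := rfl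

/-- **Mass-momentum spanning, read off `𝒫`**: `γ` contains every massive edge and joins every pair of EXTERNAL vertices — the
companion's combinatorial `IsMassMomentumSpanning` (Brown Def. 2.6; Borinsky: "subgraphs that contain all massive edges and one
connected component which connects all vertices with non-zero incoming momentum") with "non-zero incoming momentum" replaced by
BMT23's "external". BMT23's own wording ("We call a subgraph γ ⊂ E mass-momentum spanning if the second Symanzik polynomial of the
cograph G/γ vanishes identically ℱ_{G/γ} = 0", a "slightly generalized version of Brown's definition") is NOT typed for `𝒫` here;
under generic kinematics the two agree (Brown eq. (2.5), typed for vector momenta in `SecondSymanzikFactorization.lean`), for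
exceptional kinematics BMT23's predicate can hold for more `γ`. [cite: BorinskyMunchTellander2023, §3.3 (main.tex l.715–717); Borinsky2020, §7.1 (tropical.tex l.1195); Brown2017, Def. 2.6] -/
def IsMassMomentumSpanningGram (P : Matrix (Fin (V + 1)) (Fin (V + 1)) ℝ) (m : Fin N → ℝ) (γ : Finset (Fin N)) : Prop :=
  (∀ e, m e ≠ 0 → e ∈ γ) ∧ ∀ u v, IsExternal P u → IsExternal P v → (edgeGraph E γ).Reachable u v

open scoped Classical in
/-- **"z_ℱ(γ) = L_γ + 1 if γ is mass-momentum spanning and z_ℱ(γ) = L_γ otherwise"** (Theorem 3.5's boolean function), from `𝒫`,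
with `L_γ = loopNumber E γ` and m.m. in the combinatorial reading `IsMassMomentumSpanningGram`.
[cite: BorinskyMunchTellander2023, Theorem 3.5 (main.tex l.740–746)] -/
def zGram (P : Matrix (Fin (V + 1)) (Fin (V + 1)) ℝ) (m : Fin N → ℝ) (γ : Finset (Fin N)) : ℝ :=
  loopNumber E γ + if IsMassMomentumSpanningGram E P m γ then 1 else 0

end Polynomials

/-! ## Part 3 — elementary facts about `𝒫`: only external vertices count; the two sides of a cut agree; no lone external vertex; Euclidean ⊂ pseudo-Euclidean -/

section GramFacts

variable {P : Matrix (Fin (V + 1)) (Fin (V + 1)) ℝ}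

open scoped Classical in
/-- Internal vertices do not contribute to a squared momentum: `Σ_{u,v∈V'} 𝒫^{u,v} = Σ_{u,v ∈ V'∩V^ext} 𝒫^{u,v}` (symmetry of `𝒫`).
[cite: BorinskyMunchTellander2023, §2.2 (main.tex l.377–380)] -/
theorem sqMomentum_eq_filter_isExternal (hP : P.IsSymm) (S : Finset (Fin (V + 1))) :
    sqMomentum P S = sqMomentum P (S.filter fun v => IsExternal P v) := by
  unfold sqMomentum
  have hint : ∀ u v, ¬ IsExternal P v → P u v = 0 := fun u v hv => by
    by_contra h
    exact hv ⟨u, h⟩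
  have hint' : ∀ u v, ¬ IsExternal P u → P u v = 0 := fun u v hu => (hP.apply v u).trans (hint v u hu)
  symm
  rw [Finset.sum_filter_of_ne fun u _ hne => ?_]
  · refine Finset.sum_congr rfl fun u _ => ?_
    exact Finset.sum_filter_of_ne fun v _ hne => by_contra fun hv => hne (hint u v hv)
  · by_contra hu
    exact hne (Finset.sum_eq_zero fun v _ => hint' u v hu)

/-- **Momentum conservation: the two sides of a cut carry the same squared momentum** — with vanishing row sums,
`Σ_{u,v∈V∖V'} 𝒫^{u,v} = Σ_{u,v∈V'} 𝒫^{u,v}` ("vanishing row and column sums (i.e. the momentum conservation conditions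
Σ_{v∈V} p_u·p_v = Σ_{v∈V} 𝒫^{u,v} = 0 for all u ∈ V)"). [cite: BorinskyMunchTellander2023, §2.2 (main.tex l.330–331)] -/
theorem sqMomentum_compl (hP : P.IsSymm) (hcons : ∀ u, ∑ v, P u v = 0) (S : Finset (Fin (V + 1))) :
    sqMomentum P Sᶜ = sqMomentum P S := by
  classical
  unfold sqMomentum
  have hrow : ∀ u, ∑ v ∈ Sᶜ, P u v = -∑ v ∈ S, P u v := fun u => by
    have := Finset.sum_compl_add_sum S (fun v => P u v)
    rw [hcons u] at this
    linarith
  have hcol : ∀ v, ∑ u ∈ Sᶜ, P u v = -∑ u ∈ S, P u v := fun v => by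
    have := Finset.sum_compl_add_sum S (fun u => P u v)
    have h0 : ∑ u, P u v = 0 := by
      rw [show (∑ u, P u v) = ∑ u, P v u from Finset.sum_congr rfl fun u _ => hP.apply v u]
      exact hcons v
    rw [h0] at this
    linarith
  simp_rw [hrow]
  rw [Finset.sum_neg_distrib, Finset.sum_comm, Finset.sum_congr rfl fun v _ => hcol v, Finset.sum_neg_distrib, neg_neg,
    Finset.sum_comm]

/-- A vertex set containing NO external vertex has squared momentum `0`. [cite: BorinskyMunchTellander2023, §2.2 (main.tex l.377–380)] -/
theorem sqMomentum_eq_zero_of_forall_not_isExternal (hP : P.IsSymm) {S : Finset (Fin (V + 1))}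
    (h : ∀ v ∈ S, ¬ IsExternal P v) : sqMomentum P S = 0 := by
  classical
  rw [sqMomentum_eq_filter_isExternal hP, Finset.filter_false_of_mem h]
  rfl

/-- A vertex set containing ALL external vertices has squared momentum `0` (total momentum conservation).
[cite: BorinskyMunchTellander2023, §2.2 (main.tex l.330–331)] -/
theorem sqMomentum_eq_zero_of_forall_isExternal_mem (hP : P.IsSymm) (hcons : ∀ u, ∑ v, P u v = 0)
    {S : Finset (Fin (V + 1))} (h : ∀ v, IsExternal P v → v ∈ S) : sqMomentum P S = 0 := by
  classical
  rw [← sqMomentum_compl hP hcons S]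
  exact sqMomentum_eq_zero_of_forall_not_isExternal hP fun v hv hext => (Finset.mem_compl.1 hv) (h v hext)

/-- **There is no lone external vertex**: if `v` is external then so is some `u ≠ v` (a symmetric `𝒫` with vanishing row sums
whose off-diagonal entries in row `v` vanish has `𝒫^{v,v} = 0` too) — so "proper subset V' ⊊ V^ext" is never vacuous at a
singleton. [cite: BorinskyMunchTellander2023, §2.2 (main.tex l.330–331, l.377–380)] -/
theorem exists_isExternal_ne (hP : P.IsSymm) (hcons : ∀ u, ∑ v, P u v = 0) {v : Fin (V + 1)} (hv : IsExternal P v) :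
    ∃ u, IsExternal P u ∧ u ≠ v := by
  classical
  by_contra hno
  push Not at hno
  have hoff : ∀ u, u ≠ v → P u v = 0 := fun u hu => by
    have hint : ¬ IsExternal P u := fun h => hu (hno u h)
    have : P v u = 0 := by
      by_contra h
      exact hint ⟨v, h⟩
    exact (hP.apply v u).trans this
  have hdiag : P v v = 0 := by
    have h := hcons v
    rw [← Finset.sum_erase_add _ _ (Finset.mem_univ v)] at h
    rw [Finset.sum_eq_zero (fun u hu => (hP.apply u v).trans (hoff u (Finset.ne_of_mem_erase hu))),
      zero_add] at h
    exact h
  obtain ⟨u, hu⟩ := hv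
  by_cases huv : u = v
  · subst huv
    exact hu hdiag
  · exact hu (hoff u huv)

/-- **"the Euclidean regime is contained in the pseudo-Euclidean regime. To verify this, we have to make sure that a negative
semi-definite 𝒫 fulfills the conditions in (pQE)"** — pair `−𝒫` against the indicator vector of `V'`.
[cite: BorinskyMunchTellander2023, §2.2 (main.tex l.362–368)] -/
theorem IsEuclidean.isPseudoEuclidean (hE : IsEuclidean P) : IsPseudoEuclidean P := by
  classical
  intro S
  set x : Fin (V + 1) → ℝ := fun v => if v ∈ S then 1 else 0 with hx
  have h := hE.dotProduct_mulVec_nonneg x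
  rw [star_trivial, neg_mulVec, dotProduct_neg] at h
  have hq : x ⬝ᵥ (P *ᵥ x) = sqMomentum P S := by
    simp only [dotProduct, mulVec, hx, sqMomentum, ite_mul, one_mul, zero_mul, mul_ite, mul_one, mul_zero]
    rw [Finset.sum_ite_mem, Finset.univ_inter]
    refine Finset.sum_congr rfl fun u _ => ?_
    rw [Finset.sum_ite_mem, Finset.univ_inter]
  linarith

/-- The "commonly used alternative definition" `p_u·p_v ≤ 0` for all `u, v ∈ V` "is more restrictive than our condition in (pQE)":
it implies the pseudo-Euclidean regime. [cite: BorinskyMunchTellander2023, §2.2 (main.tex l.356–358)] -/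
theorem isPseudoEuclidean_of_forall_nonpos (h : ∀ u v, P u v ≤ 0) : IsPseudoEuclidean P := fun _ =>
  Finset.sum_nonpos fun u _ => Finset.sum_nonpos fun v _ => h u v

end GramFacts

/-! ## Part 4 — the monomials of the (polyUF)-shape: the coefficient of `x^{𝟙_{E∖F}}` is `c(F) + Σ_{e ∈ cut(F)} m_e²` -/

section Support

variable {E}

/-- A square-free product of variables is the monomial of its exponent vector `Σ_{e∈S} 𝟙_e`. Plumbing (as in the companion). [folklore] -/
private theorem prod_X_eq_monomial (S : Finset (Fin N)) :
    ∏ e ∈ S, (X e : MvPolynomial (Fin N) ℝ) = monomial (∑ e' ∈ S, Finsupp.single e' 1) 1 := by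
  classical
  induction S using Finset.induction_on with
  | empty => simp
  | insert e S he ih =>
    rw [Finset.prod_insert he, Finset.sum_insert he, ih, ← pow_one (X e), X_pow_eq_monomial,
      monomial_mul, one_mul]

/-- `(Σ_{e'∈S} 𝟙_{e'})(k) = [k ∈ S]`. Plumbing. [folklore] -/
private theorem sum_single_apply (S : Finset (Fin N)) (k : Fin N) :
    (∑ e' ∈ S, Finsupp.single e' (1 : ℕ)) k = if k ∈ S then 1 else 0 := by
  classical
  rw [Finsupp.coe_finsetSum, Finset.sum_apply]
  simp [Finsupp.single_apply]

/-- The square-free exponent vectors `𝟙_{E∖F}` determine `F`. Plumbing. [folklore] -/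
private theorem eq_of_sum_single_compl_eq {F F' : Finset (Fin N)}
    (h : ∑ e' ∈ Fᶜ, Finsupp.single e' (1 : ℕ) = ∑ e' ∈ F'ᶜ, Finsupp.single e' 1) : F = F' := by
  classical
  ext k
  have hk := DFunLike.congr_fun h k
  rw [sum_single_apply, sum_single_apply] at hk
  simp only [Finset.mem_compl] at hk
  by_cases h1 : k ∈ F <;> by_cases h2 : k ∈ F' <;> simp_all

/-- **The exponent `𝟙_{E∖T} + 𝟙_e` of a mass term is square-free and equal to `𝟙_{E∖F}` iff `e ∉ F` and `T = F + e`** — the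
bookkeeping behind "no cancellation between the momentum and the mass part of the ℱ-polynomial". Plumbing. [folklore] -/
private theorem sum_single_compl_add_single_eq_iff (T F : Finset (Fin N)) (e : Fin N) :
    ∑ e' ∈ Tᶜ, Finsupp.single e' (1 : ℕ) + Finsupp.single e 1 = ∑ e' ∈ Fᶜ, Finsupp.single e' 1 ↔
      e ∉ F ∧ T = insert e F := by
  classical
  constructor
  · intro h
    have hk : ∀ k, (if k ∈ Tᶜ then 1 else 0) + (if e = k then 1 else 0) = (if k ∈ Fᶜ then (1 : ℕ) else 0) := by
      intro k
      have := DFunLike.congr_fun h k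
      rwa [Finsupp.add_apply, sum_single_apply, sum_single_apply, Finsupp.single_apply] at this
    have he := hk e
    simp only [Finset.mem_compl, if_true] at he
    have heT : e ∈ T := by
      by_contra heT
      by_cases heF : e ∈ F <;> simp [heT, heF] at he
    have heF : e ∉ F := by
      intro heF
      simp [heT, heF] at he
    refine ⟨heF, ?_⟩
    ext k
    rw [Finset.mem_insert]
    by_cases hke : k = e
    · subst hke
      simp [heT]
    · have h' := hk k
      simp only [Finset.mem_compl, show (e = k) = False from propext ⟨fun h => hke h.symm, False.elim⟩,
        if_false, add_zero] at h'
      constructor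
      · intro hkT
        right
        by_contra hkF
        simp [hkT, hkF] at h'
      · rintro (h1 | hkF)
        · exact absurd h1 hke
        · by_contra hkT
          simp [hkT, hkF] at h'
  · rintro ⟨heF, rfl⟩
    ext k
    rw [Finsupp.add_apply, sum_single_apply, sum_single_apply, Finsupp.single_apply]
    simp only [Finset.mem_compl, Finset.mem_insert, not_or]
    by_cases hke : e = k
    · subst hke
      simp [heF]
    · have : ¬ (k = e) := fun h => hke h.symm
      simp [hke, this]

open scoped Classical in
/-- The (polyUF)-shape as a sum of monomials: `Σ_F c(F) X^{𝟙_{E∖F}} + Σ_T Σ_e m_e² X^{𝟙_{E∖T} + 𝟙_e}` (`𝒰 = Σ_T X^{𝟙_{E∖T}}`,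
`MatrixTreeTheorem.kirchhoffPolynomial_eq_sum_monomial`). [cite: BorinskyMunchTellander2023, §2.1 eq. (polyUF) (main.tex l.304–305)] -/
theorem twoForestPolynomial_eq_sum_monomial (c : Finset (Fin N) → ℝ) (m : Fin N → ℝ) :
    twoForestPolynomial E c m =
      (∑ F ∈ univ.filter (IsSpanningTwoForest E), c F • monomial (∑ e' ∈ Fᶜ, Finsupp.single e' 1) (1 : ℝ)) +
        ∑ T ∈ univ.filter (IsSpanningTree E), ∑ e,
          m e ^ 2 • monomial (∑ e' ∈ Tᶜ, Finsupp.single e' 1 + Finsupp.single e 1) (1 : ℝ) := by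
  unfold twoForestPolynomial
  congr 1
  · exact Finset.sum_congr rfl fun F _ => by rw [prod_X_eq_monomial]
  · rw [kirchhoffPolynomial_eq_sum_monomial E ℝ, Finset.sum_mul]
    refine Finset.sum_congr (by convert rfl) fun T _ => ?_
    rw [Finset.mul_sum]
    refine Finset.sum_congr rfl fun e _ => ?_
    rw [mul_smul_comm, ← pow_one (X e), X_pow_eq_monomial, monomial_mul, one_mul]

open scoped Classical in
/-- **The coefficients of the (polyUF)-shape**: `[X^d] = Σ_{F : 𝟙_{E∖F} = d} c(F) + Σ_{(T,e) : 𝟙_{E∖T}+𝟙_e = d} m_e²`.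
[cite: BorinskyMunchTellander2023, §2.1 eq. (polyUF) (main.tex l.304–305)] -/
theorem coeff_twoForestPolynomial (c : Finset (Fin N) → ℝ) (m : Fin N → ℝ) (d : Fin N →₀ ℕ) :
    coeff d (twoForestPolynomial E c m) =
      (∑ F ∈ univ.filter (IsSpanningTwoForest E), if ∑ e' ∈ Fᶜ, Finsupp.single e' 1 = d then c F else 0) +
        ∑ T ∈ univ.filter (IsSpanningTree E), ∑ e,
          if ∑ e' ∈ Tᶜ, Finsupp.single e' 1 + Finsupp.single e 1 = d then m e ^ 2 else 0 := by
  rw [twoForestPolynomial_eq_sum_monomial, coeff_add, coeff_sum, coeff_sum]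
  congr 1
  · refine Finset.sum_congr rfl fun F _ => ?_
    rw [coeff_smul, coeff_monomial, smul_eq_mul, mul_ite, mul_one, mul_zero]
  · refine Finset.sum_congr rfl fun T _ => ?_
    rw [coeff_sum]
    refine Finset.sum_congr rfl fun e _ => ?_
    rw [coeff_smul, coeff_monomial, smul_eq_mul, mul_ite, mul_one, mul_zero]

open scoped Classical in
/-- **The coefficient of `x^{𝟙_{E∖F}}` for a spanning 2-forest `F` is `c(F) + Σ_{e ∈ cut(F)} m_e²`**: the momentum part contributes
`c(F)` alone (`F' ↦ 𝟙_{E∖F'}` is injective) and the mass part contributes `m_e²` for exactly the pairs `(T, e) = (F + e, e)` with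
`F + e` a spanning tree — the two parts of "the momentum and the mass part of the ℱ-polynomial as defined in (polyUF)" that can
meet at a monomial. [cite: BorinskyMunchTellander2023, §2.2 (main.tex l.391–392) with §2.1 eq. (polyUF); Brown2017, Lemma 1.12 (proof)] -/
theorem coeff_twoForestPolynomial_twoForest (c : Finset (Fin N) → ℝ) (m : Fin N → ℝ) {F : Finset (Fin N)}
    (hF : IsSpanningTwoForest E F) :
    coeff (∑ e' ∈ Fᶜ, Finsupp.single e' 1) (twoForestPolynomial E c m) = c F + ∑ e ∈ cutEdges E F, m e ^ 2 := by
  rw [coeff_twoForestPolynomial]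
  congr 1
  · have h1 : ∀ F' ∈ univ.filter (IsSpanningTwoForest E),
        (if ∑ e' ∈ F'ᶜ, Finsupp.single e' 1 = ∑ e' ∈ Fᶜ, Finsupp.single e' (1 : ℕ) then c F' else 0) =
          if F' = F then c F' else 0 := fun F' _ => by
      by_cases hFF : F' = F
      · rw [if_pos hFF, if_pos (by rw [hFF])]
      · rw [if_neg hFF, if_neg fun h => hFF (eq_of_sum_single_compl_eq h)]
    rw [Finset.sum_congr rfl h1, Finset.sum_ite_eq', if_pos ((Finset.mem_filter_univ _).2 hF)]
  · rw [Finset.sum_comm]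
    refine (Finset.sum_congr rfl fun e _ => (?_ : _ = if e ∈ cutEdges E F then m e ^ 2 else 0)).trans
      (by rw [Finset.sum_ite_mem, Finset.univ_inter])
    by_cases he : e ∈ cutEdges E F
    · rw [if_pos he]
      obtain ⟨heF, hT⟩ := (Finset.mem_filter_univ e).1 he
      rw [Finset.sum_eq_single_of_mem (insert e F) ((Finset.mem_filter_univ _).2 hT) fun T _ hT' =>
        if_neg fun h => hT' ((sum_single_compl_add_single_eq_iff T F e).1 h).2]
      exact if_pos ((sum_single_compl_add_single_eq_iff _ F e).2 ⟨heF, rfl⟩)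
    · rw [if_neg he]
      refine Finset.sum_eq_zero fun T hT => if_neg fun h => he ?_
      obtain ⟨heF, rfl⟩ := (sum_single_compl_add_single_eq_iff T F e).1 h
      exact (Finset.mem_filter_univ _).2 ⟨heF, (Finset.mem_filter_univ _).1 hT⟩

/-- The mass part of a coefficient is non-negative (real masses). [cite: BorinskyMunchTellander2023, §2.1 eq. (polyUF)] -/
theorem sum_cutEdges_sq_nonneg (m : Fin N → ℝ) (F : Finset (Fin N)) : 0 ≤ ∑ e ∈ cutEdges E F, m e ^ 2 :=
  Finset.sum_nonneg fun _ _ => sq_nonneg _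

/-- **In a connected graph every spanning 2-forest has a non-empty cut**: the independent set `F` of `M(G)` with `|F| = V − 1` lies in
a basis (Mathlib `Matroid.Indep.exists_isBase_superset`), and for a connected edge list the bases of `M(G)` are the spanning trees,
of size `V` (`isBase_cycleMatroid_iff_isSpanningTree`). [cite: Oxley2011, §1.2 (bases = maximal independent sets) with §1.3 (text before eq. 1.3.6)] -/
theorem cutEdges_nonempty (hconn : IsConnectedEdgeList E) {F : Finset (Fin N)} (hF : IsSpanningTwoForest E F) :
    (cutEdges E F).Nonempty := by
  classical
  have hI : (cycleMatroid E).Indep (F : Set (Fin N)) := (indep_cycleMatroid_iff_edgeRank E F).2 hF.2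
  obtain ⟨B, hB, hFB⟩ := hI.exists_isBase_superset
  have hBfin : B.Finite := B.toFinite
  have hBT : ((hBfin.toFinset : Finset (Fin N)) : Set (Fin N)) = B := hBfin.coe_toFinset
  have hTsp : IsSpanningTree E hBfin.toFinset :=
    (isBase_cycleMatroid_iff_isSpanningTree E hconn _).1 (by rw [hBT]; exact hB)
  have hFT : F ⊆ hBfin.toFinset := fun e he => by
    rw [← Finset.mem_coe, hBT]
    exact hFB (Finset.mem_coe.2 he)
  have hcard : (hBfin.toFinset \ F).card = 1 := by
    rw [Finset.card_sdiff_of_subset hFT, hTsp.1]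
    have := hF.1
    omega
  obtain ⟨e, he⟩ := Finset.card_eq_one.1 hcard
  have heTF : e ∈ hBfin.toFinset \ F := by
    rw [he]
    exact Finset.mem_singleton_self e
  rw [Finset.mem_sdiff] at heTF
  refine ⟨e, (Finset.mem_filter_univ _).2 ⟨heTF.2, ?_⟩⟩
  have hins : insert e F = hBfin.toFinset := by
    rw [Finset.insert_eq, ← he, Finset.sdiff_union_of_subset hFT]
  rw [hins]
  exact hTsp

/-- **Support comparison for the (polyUF)-shape with fixed masses**: if at every spanning 2-forest the vanishing of
`c'(F) + Σ_{cut} m_e²` forces that of `c(F) + Σ_{cut} m_e²`, then `supp(ℱ_c) ⊆ supp(ℱ_{c'})` — all other coefficients do not see `c`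
("The ℱ polynomial has the same monomials (with different coefficients) …", proof of Theorem 3.6). [cite: BorinskyMunchTellander2023, Theorem 3.6 (proof, main.tex l.772–778)] -/
theorem support_twoForestPolynomial_subset {c c' : Finset (Fin N) → ℝ} {m : Fin N → ℝ}
    (h : ∀ F, IsSpanningTwoForest E F → c' F + ∑ e ∈ cutEdges E F, m e ^ 2 = 0 →
      c F + ∑ e ∈ cutEdges E F, m e ^ 2 = 0) :
    (twoForestPolynomial E c m).support ⊆ (twoForestPolynomial E c' m).support := by
  classical
  intro d hd
  rw [mem_support_iff] at hd ⊢
  intro h0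
  apply hd
  by_cases hex : ∃ F, IsSpanningTwoForest E F ∧ ∑ e' ∈ Fᶜ, Finsupp.single e' 1 = d
  · obtain ⟨F, hF, rfl⟩ := hex
    rw [coeff_twoForestPolynomial_twoForest c' m hF] at h0
    rw [coeff_twoForestPolynomial_twoForest c m hF]
    exact h F hF h0
  · push Not at hex
    have hz : ∀ c'' : Finset (Fin N) → ℝ, (∑ F ∈ univ.filter (IsSpanningTwoForest E),
        if ∑ e' ∈ Fᶜ, Finsupp.single e' 1 = d then c'' F else 0) = 0 := fun c'' =>
      Finset.sum_eq_zero fun F hF => if_neg (hex F ((Finset.mem_filter_univ F).1 hF))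
    rw [coeff_twoForestPolynomial, hz c'] at h0
    rw [coeff_twoForestPolynomial, hz c]
    exact h0

/-- Hence equal supports when the vanishing conditions at every spanning 2-forest are equivalent ("So, the respective Newton
polytopes coincide"). [cite: BorinskyMunchTellander2023, Theorem 3.6 (proof, main.tex l.772–778)] -/
theorem support_twoForestPolynomial_eq {c c' : Finset (Fin N) → ℝ} {m : Fin N → ℝ}
    (h : ∀ F, IsSpanningTwoForest E F → (c F + ∑ e ∈ cutEdges E F, m e ^ 2 = 0 ↔
      c' F + ∑ e ∈ cutEdges E F, m e ^ 2 = 0)) :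
    (twoForestPolynomial E c m).support = (twoForestPolynomial E c' m).support :=
  Finset.Subset.antisymm (support_twoForestPolynomial_subset fun F hF => (h F hF).2)
    (support_twoForestPolynomial_subset fun F hF => (h F hF).1)

end Support

/-! ## Part 5 — auxiliary Euclidean momenta with the externality pattern of `𝒫`; "the same monomials as in the Euclidean regime with generic kinematics" -/

section Auxiliary

variable {E}
variable {P : Matrix (Fin (V + 1)) (Fin (V + 1)) ℝ}

open scoped Classical in
/-- **Auxiliary Euclidean momenta** `p̃ : V → ℝ^V` realising the externality pattern of `𝒫` generically: `p̃_v = 𝟙_v − (1/|V^ext|)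
𝟙_{V^ext}` for external `v`, `p̃_v = 0` for internal `v` — conserved, non-zero exactly at the external vertices, and with NO non-empty
proper subset of the external vertices summing to zero. This is the device of the proof of Theorem 3.6 ("The ℱ polynomial has the
same monomials (with different coefficients) as in the Euclidean regime with generic kinematics"): it names one Euclidean generic
configuration with the same external vertices, to which the companion's Theorem 32 applies. (Not BMT23's `𝒬` with `𝒫 = −𝒬ᵀ𝒬`, which
exists only in the Euclidean regime.) [cite: BorinskyMunchTellander2023, Theorem 3.6 (proof, main.tex l.772–778)] -/
def auxMomenta (P : Matrix (Fin (V + 1)) (Fin (V + 1)) ℝ) : Fin (V + 1) → Fin (V + 1) → ℝ := fun v w =>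
  if IsExternal P v then
    (if w = v then 1 else 0) - (if IsExternal P w then 1 else 0) / ((univ.filter fun u => IsExternal P u).card : ℝ)
  else 0

/-- Internal vertices carry no auxiliary momentum. [cite: BorinskyMunchTellander2023, §2.2 (main.tex l.377–380)] -/
theorem auxMomenta_of_not_isExternal {v : Fin (V + 1)} (hv : ¬ IsExternal P v) : auxMomenta P v = 0 := by
  funext w
  simp [auxMomenta, hv]

open scoped Classical in
/-- There are at least two external vertices as soon as there is one (`exists_isExternal_ne`). [cite: BorinskyMunchTellander2023, §2.2 (main.tex l.330–331)] -/
theorem two_le_card_filter_isExternal (hP : P.IsSymm) (hcons : ∀ u, ∑ v, P u v = 0) {v : Fin (V + 1)}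
    (hv : IsExternal P v) : 2 ≤ (univ.filter fun u => IsExternal P u).card := by
  obtain ⟨u, hu, huv⟩ := exists_isExternal_ne hP hcons hv
  exact Finset.one_lt_card.2 ⟨u, (Finset.mem_filter_univ _).2 hu, v, (Finset.mem_filter_univ _).2 hv, huv⟩

/-- External vertices carry non-zero auxiliary momentum (its `v`-component is `1 − 1/|V^ext| ≥ 1/2`).
[cite: BorinskyMunchTellander2023, Theorem 3.6 (proof)] -/
theorem auxMomenta_ne_zero (hP : P.IsSymm) (hcons : ∀ u, ∑ v, P u v = 0) {v : Fin (V + 1)} (hv : IsExternal P v) :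
    auxMomenta P v ≠ 0 := by
  classical
  intro h
  have h2 : (2 : ℝ) ≤ (univ.filter fun u => IsExternal P u).card := by
    exact_mod_cast two_le_card_filter_isExternal hP hcons hv
  have := congr_fun h v
  rw [Pi.zero_apply] at this
  unfold auxMomenta at this
  rw [if_pos hv, if_pos hv, if_pos rfl, sub_eq_zero, eq_div_iff (ne_of_gt (by linarith)), one_mul] at this
  linarith

/-- `p̃_v ≠ 0 ⟺ v` is external. [cite: BorinskyMunchTellander2023, §2.2 (main.tex l.377–380), Theorem 3.6 (proof)] -/
theorem auxMomenta_ne_zero_iff (hP : P.IsSymm) (hcons : ∀ u, ∑ v, P u v = 0) (v : Fin (V + 1)) :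
    auxMomenta P v ≠ 0 ↔ IsExternal P v :=
  ⟨fun h => by_contra fun hv => h (auxMomenta_of_not_isExternal hv), auxMomenta_ne_zero hP hcons⟩

/-- The auxiliary momenta are conserved: `Σ_v p̃_v = 0`. [cite: BorinskyMunchTellander2023, §2.2 (main.tex l.330–331)] -/
theorem sum_auxMomenta (P : Matrix (Fin (V + 1)) (Fin (V + 1)) ℝ) : ∑ v, auxMomenta P v = 0 := by
  classical
  funext w
  rw [Finset.sum_apply, Pi.zero_apply]
  simp only [auxMomenta]
  rw [show (∑ v, if IsExternal P v then
        ((if w = v then 1 else 0) - (if IsExternal P w then 1 else 0) / ((univ.filter fun u => IsExternal P u).card : ℝ))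
        else 0) = ∑ v ∈ univ.filter (fun u => IsExternal P u),
        ((if w = v then 1 else 0) - (if IsExternal P w then 1 else 0) / ((univ.filter fun u => IsExternal P u).card : ℝ))
      from (Finset.sum_filter _ _).symm,
    Finset.sum_sub_distrib, Finset.sum_ite_eq, Finset.sum_const, nsmul_eq_mul]
  by_cases hw : IsExternal P w
  · have hwX : w ∈ univ.filter (fun u => IsExternal P u) := (Finset.mem_filter_univ _).2 hw
    have hk : ((univ.filter fun u => IsExternal P u).card : ℝ) ≠ 0 :=
      Nat.cast_ne_zero.2 (Finset.card_pos.2 ⟨w, hwX⟩).ne'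
    rw [if_pos hwX, if_pos hw, mul_one_div_cancel hk, sub_self]
  · have hwX : w ∉ univ.filter (fun u => IsExternal P u) := fun h => hw ((Finset.mem_filter_univ _).1 h)
    rw [if_neg hwX, if_neg hw, zero_div, mul_zero, sub_zero]

/-- **The auxiliary momenta are generic** (`IsGenericMomenta`): a non-empty proper subset `I ⊊ V^ext` has `(Σ_{v∈I} p̃_v)_u =
−|I|/|V^ext| ≠ 0` at any external `u ∉ I`. [cite: BorinskyMunchTellander2023, Theorem 3.6 (proof: "the Euclidean regime with generic kinematics")] -/
theorem isGenericMomenta_auxMomenta (hP : P.IsSymm) (hcons : ∀ u, ∑ v, P u v = 0) :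
    IsGenericMomenta (auxMomenta P) := by
  classical
  intro I hI hall hout hsum
  obtain ⟨u, huI, hu⟩ := hout
  have hu' : IsExternal P u := (auxMomenta_ne_zero_iff hP hcons u).1 hu
  have hall' : ∀ v ∈ I, IsExternal P v := fun v hv => (auxMomenta_ne_zero_iff hP hcons v).1 (hall v hv)
  set k : ℝ := ((univ.filter fun u => IsExternal P u).card : ℝ) with hk
  have h := congr_fun hsum u
  rw [Finset.sum_apply, Pi.zero_apply] at h
  have hterm : ∀ v ∈ I, auxMomenta P v u = -(1 / k) := fun v hv => by
    have huv : ¬ u = v := fun h => huI (by rw [h]; exact hv)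
    simp only [auxMomenta, if_pos (hall' v hv), if_pos hu', if_neg huv, hk]
    ring
  rw [Finset.sum_congr rfl hterm, Finset.sum_const, nsmul_eq_mul] at h
  have hkpos : (0 : ℝ) < k := by
    rw [hk]
    exact_mod_cast Finset.card_pos.2 ⟨u, (Finset.mem_filter_univ _).2 hu'⟩
  have hIc : (0 : ℝ) < I.card := by exact_mod_cast Finset.card_pos.2 hI
  have : (I.card : ℝ) * -(1 / k) < 0 := mul_neg_of_pos_of_neg hIc (by rw [neg_lt_zero]; positivity)
  linarith

/-- Momentum-spanning for `p̃` is the external-vertex condition of `IsMassMomentumSpanningGram`. [cite: BorinskyMunchTellander2023, §3.3 (main.tex l.715–717); Brown2017, Def. 1.8] -/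
theorem isMomentumSpanning_auxMomenta_iff (hP : P.IsSymm) (hcons : ∀ u, ∑ v, P u v = 0) (γ : Finset (Fin N)) :
    IsMomentumSpanning E (auxMomenta P) γ ↔ ∀ u v, IsExternal P u → IsExternal P v → (edgeGraph E γ).Reachable u v := by
  unfold IsMomentumSpanning
  simp only [auxMomenta_ne_zero_iff hP hcons]

/-- M.m. for `p̃` is `IsMassMomentumSpanningGram`. [cite: BorinskyMunchTellander2023, §3.3 (main.tex l.715–717); Brown2017, Def. 2.6] -/
theorem isMassMomentumSpanning_auxMomenta_iff (hP : P.IsSymm) (hcons : ∀ u, ∑ v, P u v = 0) (m : Fin N → ℝ)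
    (γ : Finset (Fin N)) : IsMassMomentumSpanning E (auxMomenta P) m γ ↔ IsMassMomentumSpanningGram E P m γ :=
  and_congr Iff.rfl (isMomentumSpanning_auxMomenta_iff hP hcons γ)

open scoped Classical in
/-- Hence `z_Φ(p̃, m) = z_ℱ(𝒫, m)`. [cite: BorinskyMunchTellander2023, Theorem 3.5 (main.tex l.740–746)] -/
theorem zSecondSymanzik_auxMomenta (hP : P.IsSymm) (hcons : ∀ u, ∑ v, P u v = 0) (m : Fin N → ℝ) :
    zSecondSymanzik E (auxMomenta P) m = zGram E P m := by
  funext γ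
  rw [zSecondSymanzik_apply, zGram]
  congr 1
  exact if_congr (isMassMomentumSpanning_auxMomenta_iff hP hcons m γ) rfl rfl

/-- If all external vertices lie on one side of `F`, the root side has squared momentum `0` (no externals there, or all of them).
[cite: BorinskyMunchTellander2023, §2.2 (main.tex l.330–331, l.377–380)] -/
theorem sqMomentum_rootSide_eq_zero (hP : P.IsSymm) (hcons : ∀ u, ∑ v, P u v = 0) {F : Finset (Fin N)}
    (h : ∀ u v, IsExternal P u → IsExternal P v → (edgeGraph E F).Reachable u v) :
    sqMomentum P (rootSide E F) = 0 := by
  classical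
  by_cases hex : ∃ u, IsExternal P u ∧ u ∈ rootSide E F
  · obtain ⟨u, hu, huS⟩ := hex
    refine sqMomentum_eq_zero_of_forall_isExternal_mem hP hcons fun v hv => ?_
    rw [rootSide, Finset.mem_filter_univ] at huS ⊢
    exact huS.trans (h u v hu hv)
  · push Not at hex
    exact sqMomentum_eq_zero_of_forall_not_isExternal hP fun v hvS hv => hex v hv hvS

/-- If NOT all external vertices lie on one side of the spanning 2-forest `F`, then the root side contains an external vertex and
misses another (the two components, `IsSpanningTwoForest.reachable_iff_not_reachable`). [cite: Brown2017, Lemma 1.12 (proof); BorinskyMunchTellander2023, §2.2] -/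
theorem exists_isExternal_mem_rootSide {F : Finset (Fin N)} (hF : IsSpanningTwoForest E F)
    (h : ¬ ∀ u v, IsExternal P u → IsExternal P v → (edgeGraph E F).Reachable u v) :
    (∃ a, IsExternal P a ∧ a ∈ rootSide E F) ∧ ∃ b, IsExternal P b ∧ b ∉ rootSide E F := by
  classical
  push Not at h
  obtain ⟨u, v, hu, hv, huv⟩ := h
  simp only [rootSide, Finset.mem_filter_univ]
  by_cases hu0 : (edgeGraph E F).Reachable 0 u
  · exact ⟨⟨u, hu, hu0⟩, v, hv, fun hv0 => huv (hu0.symm.trans hv0)⟩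
  · refine ⟨⟨v, hv, ?_⟩, u, hu, hu0⟩
    have h1 : ¬ (edgeGraph E F).Reachable u 0 := fun h => hu0 h.symm
    have h2 : (edgeGraph E F).Reachable v 0 := by
      by_contra h
      exact h1 ((hF.reachable_iff_not_reachable huv 0).2 h)
    exact h2.symm

/-- **Losing monomials only** (towards Theorem 3.9: "ℱ can only lose monomials if we make the kinematics less generic"): at a spanning
2-forest, if the Euclidean-generic coefficient `‖p̃(F)‖² + Σ_{cut} m_e²` vanishes then so does `−p(F)² + Σ_{cut} m_e²` — for ANY
symmetric conserved `𝒫`. [cite: BorinskyMunchTellander2023, before Theorem 3.9 (main.tex l.855–856)] -/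
theorem gramCoeff_eq_zero_of_auxCoeff_eq_zero (hP : P.IsSymm) (hcons : ∀ u, ∑ v, P u v = 0) (m : Fin N → ℝ)
    {F : Finset (Fin N)} (hF : IsSpanningTwoForest E F)
    (h0 : ‖momentumFlow E F (auxMomenta P)‖ ^ 2 + ∑ e ∈ cutEdges E F, m e ^ 2 = 0) :
    -sqMomentum P (rootSide E F) + ∑ e ∈ cutEdges E F, m e ^ 2 = 0 := by
  obtain ⟨hfl, hM⟩ := (add_eq_zero_iff_of_nonneg (sq_nonneg _) (sum_cutEdges_sq_nonneg m F)).1 h0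
  have hfl' : momentumFlow E F (auxMomenta P) = 0 := by
    rwa [sq_eq_zero_iff, norm_eq_zero] at hfl
  have hms : IsMomentumSpanning E (auxMomenta P) F := by
    by_contra hms
    exact momentumFlow_ne_zero_of_not_isMomentumSpanning hF (isGenericMomenta_auxMomenta hP hcons) hms hfl'
  rw [sqMomentum_rootSide_eq_zero hP hcons ((isMomentumSpanning_auxMomenta_iff hP hcons F).1 hms), hM, neg_zero, add_zero]

/-- **"the conditions for generic kinematics prevent cancellations between the mass and momentum part of the ℱ polynomial"**: under
generic kinematics, if `−p(F)² + Σ_{cut(F)} m_e² = 0` at a spanning 2-forest `F` of a connected graph, then all external vertices lie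
on one side of `F`, `p(F)² = 0`, the cut is massless, and `p̃(F) = 0` — the separating case is excluded by (generic kinematics) applied
to `V' = V^ext ∩ (root side)` and `E' = cut(F) ≠ ∅`. [cite: BorinskyMunchTellander2023, Theorem 3.6 (proof, main.tex l.774–777), §2.2 (main.tex l.391–392)] -/
theorem of_gramCoeff_eq_zero (hconn : IsConnectedEdgeList E) (hP : P.IsSymm) (hcons : ∀ u, ∑ v, P u v = 0)
    {m : Fin N → ℝ} (hgen : IsGeneric P m) {F : Finset (Fin N)} (hF : IsSpanningTwoForest E F)
    (h0 : -sqMomentum P (rootSide E F) + ∑ e ∈ cutEdges E F, m e ^ 2 = 0) :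
    (∀ u v, IsExternal P u → IsExternal P v → (edgeGraph E F).Reachable u v) ∧ sqMomentum P (rootSide E F) = 0 ∧
      ∑ e ∈ cutEdges E F, m e ^ 2 = 0 ∧ momentumFlow E F (auxMomenta P) = 0 := by
  classical
  have hall : ∀ u v, IsExternal P u → IsExternal P v → (edgeGraph E F).Reachable u v := by
    by_contra hsep
    obtain ⟨⟨a, ha, haS⟩, b, hb, hbS⟩ := exists_isExternal_mem_rootSide hF hsep
    have hne := hgen ((rootSide E F).filter fun v => IsExternal P v) ⟨a, Finset.mem_filter.2 ⟨haS, ha⟩⟩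
      (fun v hv => (Finset.mem_filter.1 hv).2) ⟨b, hb, fun h => hbS (Finset.mem_filter.1 h).1⟩ (cutEdges E F)
      (cutEdges_nonempty hconn hF)
    rw [← sqMomentum_eq_filter_isExternal hP] at hne
    exact hne (by linarith)
  have hsq : sqMomentum P (rootSide E F) = 0 := sqMomentum_rootSide_eq_zero hP hcons hall
  refine ⟨hall, hsq, by rwa [hsq, neg_zero, zero_add] at h0, ?_⟩
  by_contra hfl
  exact not_isMomentumSpanning_of_momentumFlow_ne_zero (sum_auxMomenta P) hfl
    ((isMomentumSpanning_auxMomenta_iff hP hcons F).2 hall)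

/-- **`supp ℱ(𝒫, m) ⊆ supp Φ(p̃, m)` for every symmetric conserved `𝒫`** on a connected graph ("ℱ can only lose monomials if we make
the kinematics less generic"). [cite: BorinskyMunchTellander2023, before Theorem 3.9 (main.tex l.855–856)] -/
theorem support_gramSecondSymanzik_subset (hP : P.IsSymm) (hcons : ∀ u, ∑ v, P u v = 0) (m : Fin N → ℝ) :
    (gramSecondSymanzik E P m).support ⊆ (secondSymanzikPolynomial E (auxMomenta P) m).support := by
  rw [secondSymanzikPolynomial_eq_twoForestPolynomial]
  exact support_twoForestPolynomial_subset fun F hF h0 => gramCoeff_eq_zero_of_auxCoeff_eq_zero hP hcons m hF h0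

/-- **"The ℱ polynomial has the same monomials (with different coefficients) as in the Euclidean regime with generic kinematics"**:
under generic kinematics on a connected graph, `supp ℱ(𝒫, m) = supp Φ(p̃, m)`. [cite: BorinskyMunchTellander2023, Theorem 3.6 (proof, main.tex l.772–778)] -/
theorem support_gramSecondSymanzik_eq (hconn : IsConnectedEdgeList E) (hP : P.IsSymm) (hcons : ∀ u, ∑ v, P u v = 0)
    {m : Fin N → ℝ} (hgen : IsGeneric P m) :
    (gramSecondSymanzik E P m).support = (secondSymanzikPolynomial E (auxMomenta P) m).support := by
  rw [secondSymanzikPolynomial_eq_twoForestPolynomial]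
  refine support_twoForestPolynomial_eq fun F hF => ⟨fun h0 => ?_, gramCoeff_eq_zero_of_auxCoeff_eq_zero hP hcons m hF⟩
  obtain ⟨-, -, hM, hfl⟩ := of_gramCoeff_eq_zero hconn hP hcons hgen hF h0
  rw [hfl, norm_zero, hM]
  ring

/-- **No cancellation, coefficient form**: under generic kinematics a spanning 2-forest `F` with `p(F)² ≠ 0` contributes the monomial
`x^{𝟙_{E∖F}}` to `ℱ` ("Genericity, for instance, guarantees that there will be no cancellation between the momentum and the mass part
of the ℱ-polynomial as defined in (polyUF)"). [cite: BorinskyMunchTellander2023, §2.2 (main.tex l.391–392)] -/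
theorem coeff_gramSecondSymanzik_ne_zero (hconn : IsConnectedEdgeList E) (hP : P.IsSymm) (hcons : ∀ u, ∑ v, P u v = 0)
    {m : Fin N → ℝ} (hgen : IsGeneric P m) {F : Finset (Fin N)} (hF : IsSpanningTwoForest E F)
    (hsq : sqMomentum P (rootSide E F) ≠ 0) :
    coeff (∑ e' ∈ Fᶜ, Finsupp.single e' 1) (gramSecondSymanzik E P m) ≠ 0 := by
  rw [gramSecondSymanzik, coeff_twoForestPolynomial_twoForest _ m hF]
  exact fun h0 => hsq (of_gramCoeff_eq_zero hconn hP hcons hgen hF h0).2.1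

end Auxiliary

/-! ## Part 6 — THEOREM 3.6 and THEOREM 3.9 from `𝒫`; the pseudo-Euclidean sign statements; on-shell ⇒ exceptional -/

/-- The exponent vectors of `p` read in `ℝⁿ` — the companion's local notation (no new definition). -/
local notation3 (prettyPrint := false) "pts⟦" p "⟧" =>
  ((fun d : (_ →₀ ℕ) => fun k => ((d k : ℕ) : ℝ)) '' {d | d ∈ MvPolynomial.support p})

/-- The Newton polytope `NP_p = conv(supp p)` — the companion's local notation (no new definition). -/
local notation3 (prettyPrint := false) "NP⟦" p "⟧" => convexHull ℝ pts⟦p⟧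

section Main

variable {E}
variable {P : Matrix (Fin (V + 1)) (Fin (V + 1)) ℝ}

/-- **THEOREM 3.6 (Borinsky–Munch–Tellander 2023), AS PRINTED: "Theorem 3.5 holds in all regimes if the kinematics are generic."**
— i.e. "the Newton polytope N[ℱ] is a generalized permutahedron. It is equal to the base polytope P[z_ℱ] with the function z_ℱ defined
for all subgraphs γ by z_ℱ(γ) = L_γ + 1 if γ is mass-momentum spanning and z_ℱ(γ) = L_γ otherwise", now for `ℱ` built from ANY
symmetric `𝒫` with vanishing row sums (Euclidean, pseudo-Euclidean or Minkowski) and real masses, under (generic kinematics), on a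
connected edge list; `P[z] =` the tree's facet presentation `gpPolytope`, m.m. in the combinatorial reading (see
`IsMassMomentumSpanningGram`). Printed proof, followed: "The ℱ polynomial has the same monomials (with different coefficients) as in
the Euclidean regime with generic kinematics [`support_gramSecondSymanzik_eq`, via the auxiliary momenta `p̃`] … So, the respective
Newton polytopes coincide" — and the Euclidean generic case is the companion's `newtonPolytope_secondSymanzikPolynomial_eq_gpPolytope`
(Borinsky Theorem 32 = BMT23 Theorem 3.5). [cite: BorinskyMunchTellander2023, Theorem 3.6 (main.tex l.766–779) with Theorem 3.5 (l.740–748)] -/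
theorem newtonPolytope_gramSecondSymanzik_eq_gpPolytope (hconn : IsConnectedEdgeList E) (hP : P.IsSymm)
    (hcons : ∀ u, ∑ v, P u v = 0) {m : Fin N → ℝ} (hgen : IsGeneric P m) :
    NP⟦gramSecondSymanzik E P m⟧ = gpPolytope (zGram E P m) := by
  rw [support_gramSecondSymanzik_eq hconn hP hcons hgen,
    newtonPolytope_secondSymanzikPolynomial_eq_gpPolytope hconn (sum_auxMomenta P) (isGenericMomenta_auxMomenta hP hcons) m,
    zSecondSymanzik_auxMomenta hP hcons m]

/-- **"Consequently, this function z_ℱ : 2^E → ℝ is supermodular"** — for every symmetric conserved `𝒫` (it is the companion's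
`z_Φ` of the auxiliary momenta). [cite: BorinskyMunchTellander2023, Theorem 3.5/3.6 (main.tex l.747, l.768–769)] -/
theorem supermodular_zGram (hP : P.IsSymm) (hcons : ∀ u, ∑ v, P u v = 0) (m : Fin N → ℝ) :
    Supermodular (zGram E P m) := by
  rw [← zSecondSymanzik_auxMomenta hP hcons m]
  exact supermodular_zSecondSymanzik _ _

/-- **THEOREM 3.9 (Borinsky–Munch–Tellander 2023): "Even if N[ℱ] ≠ P[z_ℱ], the Newton polytope N[ℱ] is *bounded* by the base polytope
P[z_ℱ]. The reason for this is that ℱ can only lose monomials if we make the kinematics less generic. Theorem 3.9. We have N[ℱ] ⊂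
P[z_ℱ]."** For `ℱ` from ANY symmetric `𝒫` with vanishing row sums and real masses on a connected edge list, NO genericity hypothesis,
with `z_ℱ = zGram` (m.m. in the combinatorial reading). SCOPE CAVEAT (disclosed): with BMT23's own m.m. predicate `ℱ_{G/γ} = 0`, which
for exceptional kinematics may hold for more `γ`, `z_ℱ ≥ zGram` pointwise and the printed `P[z_ℱ]` can be smaller — that sharper
inclusion is not typed here. [cite: BorinskyMunchTellander2023, Theorem 3.9 (main.tex l.855–859)] -/
theorem newtonPolytope_gramSecondSymanzik_subset_gpPolytope (hconn : IsConnectedEdgeList E) (hP : P.IsSymm)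
    (hcons : ∀ u, ∑ v, P u v = 0) (m : Fin N → ℝ) :
    NP⟦gramSecondSymanzik E P m⟧ ⊆ gpPolytope (zGram E P m) := by
  rw [← zSecondSymanzik_auxMomenta hP hcons m]
  exact (convexHull_mono (Set.image_mono fun d hd => support_gramSecondSymanzik_subset hP hcons m hd)).trans
    (newtonPolytope_secondSymanzikPolynomial_subset_gpPolytope hconn (sum_auxMomenta P) m)

/-- **"By (polyUF) and (pQE), the coefficients of ℱ are non-negative in the pseudo-Euclidean regime."**
[cite: BorinskyMunchTellander2023, §2.2 (main.tex l.352–353)] -/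
theorem coeff_gramSecondSymanzik_nonneg (hPE : IsPseudoEuclidean P) (m : Fin N → ℝ) (d : Fin N →₀ ℕ) :
    0 ≤ coeff d (gramSecondSymanzik E P m) := by
  classical
  rw [gramSecondSymanzik, coeff_twoForestPolynomial]
  exact add_nonneg (Finset.sum_nonneg fun F _ => ite_nonneg (neg_nonneg.2 (hPE _)) le_rfl)
    (Finset.sum_nonneg fun T _ => Finset.sum_nonneg fun e _ => ite_nonneg (sq_nonneg _) le_rfl)

/-- **"In this regime, ℱ(x) ≥ 0 for all x ∈ ℙ^E_+"** / "In fact, ℱ(x) ≥ 0 for all x ∈ ℙ^E_+ in a larger kinematic regime" — the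
pseudo-Euclidean one: `ℱ` takes non-negative values on the closed positive orthant. [cite: BorinskyMunchTellander2023, §2.2 (main.tex l.335, l.344–345)] -/
theorem eval_gramSecondSymanzik_nonneg (hPE : IsPseudoEuclidean P) (m : Fin N → ℝ) {x : Fin N → ℝ} (hx : ∀ e, 0 ≤ x e) :
    0 ≤ eval x (gramSecondSymanzik E P m) := by
  rw [MvPolynomial.eval_eq']
  exact Finset.sum_nonneg fun d _ =>
    mul_nonneg (coeff_gramSecondSymanzik_nonneg hPE m d) (Finset.prod_nonneg fun i _ => pow_nonneg (hx i) _)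

/-- The same two statements in the Euclidean regime ("the Euclidean regime is contained in the pseudo-Euclidean regime").
[cite: BorinskyMunchTellander2023, §2.2 (main.tex l.335, l.362–363)] -/
theorem eval_gramSecondSymanzik_nonneg_of_isEuclidean (hE : IsEuclidean P) (m : Fin N → ℝ) {x : Fin N → ℝ}
    (hx : ∀ e, 0 ≤ x e) : 0 ≤ eval x (gramSecondSymanzik E P m) :=
  eval_gramSecondSymanzik_nonneg hE.isPseudoEuclidean m hx

/-- **On-shell external momenta are exceptional as soon as one propagator is massless**: "generic kinematics also exclude *on-shell
external momenta*, i.e. cases where p_v² = 𝒫^{v,v} = 0 for some v ∈ V^ext as long as not all m_e > 0, for then there exists at least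
one edge e ∈ E such that p_v² = 0 = m_e², thus violating (generic kinematics)" (`V' = {v}` is proper by `exists_isExternal_ne`,
`E' = {e}`). [cite: BorinskyMunchTellander2023, §2.2 (main.tex l.388–391)] -/
theorem IsGeneric.apply_self_ne_zero (hP : P.IsSymm) (hcons : ∀ u, ∑ v, P u v = 0) {m : Fin N → ℝ} (hgen : IsGeneric P m)
    {e : Fin N} (he : m e = 0) {v : Fin (V + 1)} (hv : IsExternal P v) : P v v ≠ 0 := by
  obtain ⟨u, hu, huv⟩ := exists_isExternal_ne hP hcons hv
  have h := hgen {v} ⟨v, Finset.mem_singleton_self v⟩ (fun w hw => by rwa [Finset.mem_singleton.1 hw])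
    ⟨u, hu, by rwa [Finset.mem_singleton]⟩ {e} ⟨e, Finset.mem_singleton_self e⟩
  simpa [sqMomentum, he] using h

/-- Contrapositive: an on-shell external vertex and a massless edge make the kinematics exceptional. [cite: BorinskyMunchTellander2023, §2.2 (main.tex l.388–391, l.394)] -/
theorem isExceptional_of_onShell (hP : P.IsSymm) (hcons : ∀ u, ∑ v, P u v = 0) {m : Fin N → ℝ} {e : Fin N} (he : m e = 0)
    {v : Fin (V + 1)} (hv : IsExternal P v) (h0 : P v v = 0) : IsExceptional P m := fun hgen =>
  hgen.apply_self_ne_zero hP hcons he hv h0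

/-- **"the kinematics are always generic in the pseudo-Euclidean regime if m_e > 0 for all e ∈ E"** (then `Σ_{u,v∈V'} 𝒫^{u,v} ≤ 0
< Σ_{e∈E'} m_e²` for non-empty `E'`; stated for `m_e ≠ 0`, masses entering through `m_e²`). [cite: BorinskyMunchTellander2023, §2.2 (main.tex l.388–390)] -/
theorem IsPseudoEuclidean.isGeneric_of_forall_ne_zero (hPE : IsPseudoEuclidean P) {m : Fin N → ℝ} (hm : ∀ e, m e ≠ 0) :
    IsGeneric P m := by
  intro S _ _ _ E' hE' h
  have h1 : 0 < ∑ e ∈ E', m e ^ 2 := Finset.sum_pos (fun e _ => by have := hm e; positivity) hE'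
  linarith [hPE S]

/-- **"… or if Σ_{u,v∈V'} 𝒫^{u,v} < 0 for all V' ⊊ V^ext"** (non-empty proper `V'`, see `IsGeneric`): then the kinematics are generic
for every real mass assignment, `Σ_{e∈E'} m_e² ≥ 0`. [cite: BorinskyMunchTellander2023, §2.2 (main.tex l.388–390)] -/
theorem isGeneric_of_sqMomentum_neg
    (h : ∀ S : Finset (Fin (V + 1)), S.Nonempty → (∀ v ∈ S, IsExternal P v) → (∃ v, IsExternal P v ∧ v ∉ S) →
      sqMomentum P S < 0) (m : Fin N → ℝ) : IsGeneric P m := by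
  intro S hS hall hout E' _ heq
  have h1 := h S hS hall hout
  have h2 : 0 ≤ ∑ e ∈ E', m e ^ 2 := Finset.sum_nonneg fun e _ => sq_nonneg _
  linarith

end Main

/-! ## Part 7 — dictionary: Euclidean vector momenta `p̃_v ∈ W` give `𝒫 = −(⟪p̃_u, p̃_v⟫)`, in the Euclidean regime, with `ℱ(𝒫) = Φ_G(p̃)` -/

section Dictionary

variable {E}
variable {W : Type*} [NormedAddCommGroup W] [InnerProductSpace ℝ W]

/-- **`𝒫^{u,v} = −p̃_uᵀ p̃_v`** — "Elements of 𝒫 can be interpreted as Euclidean, all-minus metric, scalar products of the p̃_v-vectors: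
𝒫^{u,v} = −p̃_uᵀ p̃_v": the kinematic matrix of a family of Euclidean momentum vectors (minus Mathlib's Gram matrix `Matrix.gram`).
[cite: BorinskyMunchTellander2023, §2.2 "Euclidean regime" (main.tex l.338–341)] -/
def allMinusGram (p : Fin (V + 1) → W) : Matrix (Fin (V + 1)) (Fin (V + 1)) ℝ := -Matrix.gram ℝ p

/-- Entries: `𝒫^{u,v} = −⟪p̃_u, p̃_v⟫`. [cite: BorinskyMunchTellander2023, §2.2 (main.tex l.340–341)] -/
theorem allMinusGram_apply (p : Fin (V + 1) → W) (u v : Fin (V + 1)) : allMinusGram p u v = -inner ℝ (p u) (p v) := rfl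

/-- `𝒫` is symmetric. [cite: BorinskyMunchTellander2023, §2.2 (main.tex l.329–330)] -/
theorem isSymm_allMinusGram (p : Fin (V + 1) → W) : (allMinusGram p).IsSymm :=
  Matrix.IsSymm.ext fun u v => by rw [allMinusGram_apply, allMinusGram_apply, real_inner_comm]

/-- Momentum conservation `Σ_v p̃_v = 0` gives vanishing row sums. [cite: BorinskyMunchTellander2023, §2.2 (main.tex l.330–331)] -/
theorem sum_allMinusGram {p : Fin (V + 1) → W} (hcons : ∑ v, p v = 0) (u : Fin (V + 1)) :
    ∑ v, allMinusGram p u v = 0 := by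
  simp only [allMinusGram_apply]
  rw [Finset.sum_neg_distrib, ← inner_sum, hcons, inner_zero_right, neg_zero]

/-- **Such a `𝒫` is in the Euclidean regime** ("as −𝒫 is positive semi-definite, there is a |V|×|V| matrix 𝒬 such that 𝒫 = −𝒬ᵀ𝒬" —
conversely a matrix of this form is negative semi-definite: Mathlib's `Matrix.posSemidef_gram`). [cite: BorinskyMunchTellander2023, §2.2 (main.tex l.334–341)] -/
theorem isEuclidean_allMinusGram (p : Fin (V + 1) → W) : IsEuclidean (allMinusGram p) := by
  rw [IsEuclidean, allMinusGram, neg_neg]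
  exact Matrix.posSemidef_gram ℝ p

/-- `Σ_{u,v∈V'} 𝒫^{u,v} = −‖Σ_{v∈V'} p̃_v‖²` (the displayed verification of Euclidean ⊂ pseudo-Euclidean).
[cite: BorinskyMunchTellander2023, §2.2 (main.tex l.365–367)] -/
theorem sqMomentum_allMinusGram (p : Fin (V + 1) → W) (S : Finset (Fin (V + 1))) :
    sqMomentum (allMinusGram p) S = -‖∑ v ∈ S, p v‖ ^ 2 := by
  simp only [sqMomentum, allMinusGram_apply, Finset.sum_neg_distrib]
  rw [← real_inner_self_eq_norm_sq, sum_inner]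
  congr 1
  exact Finset.sum_congr rfl fun u _ => (inner_sum _ _ _).symm

/-- External = non-zero momentum: `v ∈ V^ext ⟺ p̃_v ≠ 0`. [cite: BorinskyMunchTellander2023, §2.2 (main.tex l.377–380)] -/
theorem isExternal_allMinusGram_iff (p : Fin (V + 1) → W) (v : Fin (V + 1)) : IsExternal (allMinusGram p) v ↔ p v ≠ 0 := by
  constructor
  · rintro ⟨u, hu⟩ hv
    apply hu
    rw [allMinusGram_apply, hv, inner_zero_right, neg_zero]
  · intro hv
    refine ⟨v, ?_⟩
    rw [allMinusGram_apply, real_inner_self_eq_norm_sq, neg_ne_zero]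
    positivity

/-- **`ℱ(𝒫) = Φ_G(p̃)`**: for `𝒫 = −(⟪p̃_u,p̃_v⟫)` the polynomial of eq. (polyUF) IS the companion's Euclidean second Symanzik polynomial
(`−p(F)² = ‖p̃(F)‖²`). [cite: BorinskyMunchTellander2023, §2.1 eq. (polyUF), §2.2 (main.tex l.336–341); Borinsky2020, §7.1 eq. (PsiPhi_slow)] -/
theorem gramSecondSymanzik_allMinusGram (p : Fin (V + 1) → W) (m : Fin N → ℝ) :
    gramSecondSymanzik E (allMinusGram p) m = secondSymanzikPolynomial E p m := by
  rw [secondSymanzikPolynomial_eq_twoForestPolynomial, gramSecondSymanzik]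
  congr 1
  funext F
  rw [sqMomentum_allMinusGram, neg_neg, momentumFlow_eq_sum_rootSide]

/-- M.m. from `𝒫 = −(⟪p̃_u,p̃_v⟫)` is the companion's m.m. for `p̃`. [cite: BorinskyMunchTellander2023, §3.3 (main.tex l.715–717); Brown2017, Def. 2.6] -/
theorem isMassMomentumSpanningGram_allMinusGram_iff (p : Fin (V + 1) → W) (m : Fin N → ℝ) (γ : Finset (Fin N)) :
    IsMassMomentumSpanningGram E (allMinusGram p) m γ ↔ IsMassMomentumSpanning E p m γ := by
  unfold IsMassMomentumSpanningGram IsMassMomentumSpanning IsMomentumSpanning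
  simp only [isExternal_allMinusGram_iff]

open scoped Classical in
/-- Hence `z_ℱ(𝒫) = z_Φ(p̃)`. [cite: BorinskyMunchTellander2023, Theorem 3.5 (main.tex l.740–746); Borinsky2020, Theorem 32] -/
theorem zGram_allMinusGram (p : Fin (V + 1) → W) (m : Fin N → ℝ) : zGram E (allMinusGram p) m = zSecondSymanzik E p m := by
  funext γ
  rw [zGram, zSecondSymanzik_apply]
  congr 1
  exact if_congr (isMassMomentumSpanningGram_allMinusGram_iff p m γ) rfl rfl

/-- **Euclidean generic momenta are generic kinematics** (for every real mass assignment: `−‖Σ_{V'} p̃‖² < 0 ≤ Σ_{E'} m_e²`; Brown's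
second condition (genericmassmomenta) is automatic in the Euclidean region). [cite: BorinskyMunchTellander2023, §2.2 (main.tex l.388–390); Brown2017, §1.7 Def. 1.15] -/
theorem IsGenericMomenta.isGeneric_allMinusGram {p : Fin (V + 1) → W} (hgen : IsGenericMomenta p) (m : Fin N → ℝ) :
    IsGeneric (allMinusGram p) m := by
  refine isGeneric_of_sqMomentum_neg (fun S hS hall hout => ?_) m
  rw [sqMomentum_allMinusGram, neg_lt_zero]
  have hne : ∑ v ∈ S, p v ≠ 0 := hgen S hS (fun v hv => (isExternal_allMinusGram_iff p v).1 (hall v hv))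
    (by obtain ⟨v, hv, hvS⟩ := hout; exact ⟨v, hvS, (isExternal_allMinusGram_iff p v).1 hv⟩)
  positivity

/-- Consistency: Theorem 3.6 from `𝒫 = −(⟪p̃_u,p̃_v⟫)` gives back the companion's Theorem 32 / BMT23 Theorem 3.5 for Euclidean generic
momenta in an inner-product space. [cite: BorinskyMunchTellander2023, Theorem 3.5 (main.tex l.740–748); Borinsky2020, Theorem 32] -/
theorem newtonPolytope_secondSymanzikPolynomial_eq_gpPolytope_of_inner (hconn : IsConnectedEdgeList E) {p : Fin (V + 1) → W}
    (hcons : ∑ v, p v = 0) (hgen : IsGenericMomenta p) (m : Fin N → ℝ) :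
    NP⟦secondSymanzikPolynomial E p m⟧ = gpPolytope (zSecondSymanzik E p m) := by
  rw [← gramSecondSymanzik_allMinusGram, ← zGram_allMinusGram]
  exact newtonPolytope_gramSecondSymanzik_eq_gpPolytope hconn (isSymm_allMinusGram p) (sum_allMinusGram hcons)
    (IsGenericMomenta.isGeneric_allMinusGram hgen m)

end Dictionary

end Literature.MathematicalPhysics.QuantumFieldTheory.BorinskyMunchTellander2023
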